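import Summits.QuantumFields.YangMills.Theorems.AllWindowsColdBoxBoxHighLineSimplexFlow
import Summits.QuantumFields.YangMills.Theorems.AllWindowsColdBoxDirFreeVarOctantEnergy

/-!
# LINE-19, toward S3a `LandauVarianceBounded` (crux `AllWindowsColdBox.BoxHighWindowsSU22`, stmt-QuantumFields-24004 / low item 24335),
# part 2: the energy of the simplex flow is at most `4`

* `sum_le_sum_param` — a generic covering bound (a non-negative function supported on an injectively parametrised set);
* `param_apply*` — the three-offset parametrisation `x + a e_{τ₀} + b e_{τ₁} + c e_{τ₂}` of the slice (`τ_j = i.succAbove j`);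
* `flow_energy_le` — **`Σ_{τ≠i} Σ_y θ(y,τ)² ≤ 4`**: per vertex the squared out-weights are at most `φ(m)²`, and
  `Σ_{a,b,c<N} φ(a+b+c)² ≤ 4` is the tree's `…AllWindowsColdBoxDirFreeVar.sum_theta_sq_le_four` (LINE-17's octant flow series).
HONEST LABEL: helper toward the first conjunct (S3a `LandauVarianceBounded`) of registered stub S3 of a critic-PASSed line on
the R2ξ″ crux ⟨24004⟩; no crux, rung or summit is proved; the Yang–Mills mass gap is NOT proved by this file.
-/

set_option autoImplicit false

open Finset

namespace Summit.QuantumFields.YangMills.Theorems.AllWindowsColdBoxBoxHighLine.HodgePoincare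

open Summit.QuantumFields.YangMills.Theorems.AllWindowsColdBoxDirFreeVar (sum_theta_sq_le_four)

/-- A generic covering bound: a non-negative function supported on the image of an injective parametrisation is summed
over the box by summing over the parameters. -/
theorem sum_le_sum_param {β : Type*} [DecidableEq β] {a b : ℤ} (U : Finset β) (ι : β → (Fin 4 → ℤ)) (hι : Set.InjOn ι U)
    (F : (Fin 4 → ℤ) → ℝ) (hF : ∀ y, 0 ≤ F y) (hsupp : ∀ y, F y ≠ 0 → ∃ u ∈ U, ι u = y) :
    ∑ y ∈ Fintype.piFinset (fun _ : Fin 4 => Finset.Icc a b), F y ≤ ∑ u ∈ U, F (ι u) := by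
  rw [← Finset.sum_image (f := F) hι]
  have h1 : ∑ y ∈ Fintype.piFinset (fun _ : Fin 4 => Finset.Icc a b), F y =
      ∑ y ∈ Fintype.piFinset (fun _ : Fin 4 => Finset.Icc a b) ∩ U.image ι, F y := by
    refine (Finset.sum_subset Finset.inter_subset_left fun y hy hyn => ?_).symm
    by_contra hne
    obtain ⟨u, hu, rfl⟩ := hsupp _ hne
    exact hyn (Finset.mem_inter.2 ⟨hy, Finset.mem_image.2 ⟨u, hu, rfl⟩⟩)
  rw [h1]
  exact Finset.sum_le_sum_of_subset_of_nonneg Finset.inter_subset_right fun y _ _ => hF y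

/-- Evaluation of the three-offset parametrisation of the slice through `x` normal to `i`. -/
theorem param_apply (i : Fin 4) (x : Fin 4 → ℤ) (a b c : ℤ) (k : Fin 4) :
    (x + Pi.single (i.succAbove 0) a + Pi.single (i.succAbove 1) b + Pi.single (i.succAbove 2) c : Fin 4 → ℤ) k =
      x k + (if k = i.succAbove 0 then a else 0) + (if k = i.succAbove 1 then b else 0) + (if k = i.succAbove 2 then c else 0) := by
  simp only [Pi.add_apply, Pi.single_apply]

/-- `Fin.succAbove i` is injective (inequality form). -/
theorem succAbove_ne_succAbove (i : Fin 4) {j j' : Fin 3} (h : j ≠ j') : i.succAbove j ≠ i.succAbove j' :=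
  fun e => h (Fin.succAbove_right_injective e)

/-- The parametrisation at the first transverse direction. -/
theorem param_apply_zero (i : Fin 4) (x : Fin 4 → ℤ) (a b c : ℤ) :
    (x + Pi.single (i.succAbove 0) a + Pi.single (i.succAbove 1) b + Pi.single (i.succAbove 2) c : Fin 4 → ℤ) (i.succAbove 0) =
      x (i.succAbove 0) + a := by
  rw [param_apply, if_pos rfl, if_neg (succAbove_ne_succAbove i (by decide : (0 : Fin 3) ≠ 1)),
    if_neg (succAbove_ne_succAbove i (by decide : (0 : Fin 3) ≠ 2))]; ring

/-- The parametrisation at the second transverse direction. -/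
theorem param_apply_one (i : Fin 4) (x : Fin 4 → ℤ) (a b c : ℤ) :
    (x + Pi.single (i.succAbove 0) a + Pi.single (i.succAbove 1) b + Pi.single (i.succAbove 2) c : Fin 4 → ℤ) (i.succAbove 1) =
      x (i.succAbove 1) + b := by
  rw [param_apply, if_neg (succAbove_ne_succAbove i (by decide : (1 : Fin 3) ≠ 0)), if_pos rfl,
    if_neg (succAbove_ne_succAbove i (by decide : (1 : Fin 3) ≠ 2))]; ring

/-- The parametrisation at the third transverse direction. -/
theorem param_apply_two (i : Fin 4) (x : Fin 4 → ℤ) (a b c : ℤ) :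
    (x + Pi.single (i.succAbove 0) a + Pi.single (i.succAbove 1) b + Pi.single (i.succAbove 2) c : Fin 4 → ℤ) (i.succAbove 2) =
      x (i.succAbove 2) + c := by
  rw [param_apply, if_neg (succAbove_ne_succAbove i (by decide : (2 : Fin 3) ≠ 0)),
    if_neg (succAbove_ne_succAbove i (by decide : (2 : Fin 3) ≠ 1)), if_pos rfl]; ring

/-- The parametrisation stays in the slice `{y_i = x_i}`. -/
theorem param_apply_self (i : Fin 4) (x : Fin 4 → ℤ) (a b c : ℤ) :
    (x + Pi.single (i.succAbove 0) a + Pi.single (i.succAbove 1) b + Pi.single (i.succAbove 2) c : Fin 4 → ℤ) i = x i := by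
  rw [param_apply, if_neg (Fin.succAbove_ne i 0).symm, if_neg (Fin.succAbove_ne i 1).symm, if_neg (Fin.succAbove_ne i 2).symm]
  ring

/-- **Energy of the simplex flow**: `Σ_{τ ≠ i} Σ_y θ(y,τ)² ≤ 4` (Pólya-urn weights; the series is the tree's
`sum_theta_sq_le_four`). -/
theorem flow_energy_le (N : ℕ) (i : Fin 4) (x : Fin 4 → ℤ) (hx : ∀ k, 0 ≤ x k)
    (m : (Fin 4 → ℤ) → ℤ) (hm : ∀ y, m y = ∑ k : Fin 4, (if k ≠ i then y k - x k else 0))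
    (θ : (Fin 4 → ℤ) → Fin 4 → ℝ)
    (hθ : ∀ y τ, θ y τ = if (τ ≠ i ∧ y i = x i ∧ ∀ k, k ≠ i → x k ≤ y k ∧ y k + 1 ≤ N) then
      2 / (((m y : ℝ) + 1) * ((m y : ℝ) + 2)) * (((y τ - x τ : ℤ) : ℝ) + 1) / ((m y : ℝ) + 3) else 0) :
    ∑ τ : Fin 4, (if τ ≠ i then
      ∑ y ∈ Fintype.piFinset (fun _ : Fin 4 => Finset.Icc (-2 : ℤ) (N + 2)), θ y τ ^ 2 else 0) ≤ 4 := by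
  have h01 : i.succAbove 0 ≠ i.succAbove 1 := succAbove_ne_succAbove i (by decide)
  have h02 : i.succAbove 0 ≠ i.succAbove 2 := succAbove_ne_succAbove i (by decide)
  have h12 : i.succAbove 1 ≠ i.succAbove 2 := succAbove_ne_succAbove i (by decide)
  -- swap and bound pointwise
  have h1 : ∑ τ : Fin 4, (if τ ≠ i then
      ∑ y ∈ Fintype.piFinset (fun _ : Fin 4 => Finset.Icc (-2 : ℤ) (N + 2)), θ y τ ^ 2 else 0) =
      ∑ y ∈ Fintype.piFinset (fun _ : Fin 4 => Finset.Icc (-2 : ℤ) (N + 2)), ∑ τ : Fin 4, (if τ ≠ i then θ y τ ^ 2 else 0) := by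
    rw [Finset.sum_comm]
    refine Finset.sum_congr rfl fun τ _ => ?_
    by_cases h : τ ≠ i
    · rw [if_pos h]; exact Finset.sum_congr rfl fun y _ => by rw [if_pos h]
    · rw [if_neg h]; exact (Finset.sum_eq_zero fun y _ => by rw [if_neg h]).symm
  rw [h1]
  refine le_trans (Finset.sum_le_sum fun y _ => energy_pointwise m hm θ hθ y) ?_
  -- the region indicator times φ², and its value on the parametrisation
  have hF0 : ∀ y : Fin 4 → ℤ, 0 ≤ (if (y i = x i ∧ ∀ k, k ≠ i → x k ≤ y k ∧ y k + 1 ≤ N) then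
      (2 / (((m y : ℝ) + 1) * ((m y : ℝ) + 2))) ^ 2 else 0) := fun y => by split_ifs <;> positivity
  have hmval : ∀ a b c : ℕ, m (x + Pi.single (i.succAbove 0) (a : ℤ) + Pi.single (i.succAbove 1) (b : ℤ) +
      Pi.single (i.succAbove 2) (c : ℤ)) = a + b + c := by
    intro a b c
    rw [hm, Fin.sum_univ_succAbove _ i, Fin.sum_univ_three, if_neg (not_not.2 rfl), if_pos (Fin.succAbove_ne i 0),
      if_pos (Fin.succAbove_ne i 1), if_pos (Fin.succAbove_ne i 2), param_apply_zero, param_apply_one, param_apply_two]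
    ring
  have hval : ∀ u : (ℕ × ℕ) × ℕ,
      (if ((x + Pi.single (i.succAbove 0) (u.1.1 : ℤ) + Pi.single (i.succAbove 1) (u.1.2 : ℤ) +
          Pi.single (i.succAbove 2) (u.2 : ℤ) : Fin 4 → ℤ) i = x i ∧ ∀ k, k ≠ i → x k ≤
          (x + Pi.single (i.succAbove 0) (u.1.1 : ℤ) + Pi.single (i.succAbove 1) (u.1.2 : ℤ) +
          Pi.single (i.succAbove 2) (u.2 : ℤ) : Fin 4 → ℤ) k ∧
          (x + Pi.single (i.succAbove 0) (u.1.1 : ℤ) + Pi.single (i.succAbove 1) (u.1.2 : ℤ) +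
          Pi.single (i.succAbove 2) (u.2 : ℤ) : Fin 4 → ℤ) k + 1 ≤ N) then
        (2 / (((m (x + Pi.single (i.succAbove 0) (u.1.1 : ℤ) + Pi.single (i.succAbove 1) (u.1.2 : ℤ) +
          Pi.single (i.succAbove 2) (u.2 : ℤ)) : ℝ) + 1) *
          ((m (x + Pi.single (i.succAbove 0) (u.1.1 : ℤ) + Pi.single (i.succAbove 1) (u.1.2 : ℤ) +
          Pi.single (i.succAbove 2) (u.2 : ℤ)) : ℝ) + 2))) ^ 2 else 0) ≤
      (4 : ℝ) / (((u.1.1 : ℝ) + u.1.2 + u.2 + 1) ^ 2 * ((u.1.1 : ℝ) + u.1.2 + u.2 + 2) ^ 2) := by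
    intro u
    have hpos : (0 : ℝ) ≤ 4 / (((u.1.1 : ℝ) + u.1.2 + u.2 + 1) ^ 2 * ((u.1.1 : ℝ) + u.1.2 + u.2 + 2) ^ 2) := by positivity
    split_ifs
    · rw [hmval]; push_cast
      rw [div_pow, mul_pow]
      norm_num
    · exact hpos
  have key := sum_le_sum_param (a := -2) (b := (N : ℤ) + 2)
    ((Finset.range N ×ˢ Finset.range N) ×ˢ Finset.range N)
    (fun u : (ℕ × ℕ) × ℕ => x + Pi.single (i.succAbove 0) (u.1.1 : ℤ) + Pi.single (i.succAbove 1) (u.1.2 : ℤ) +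
      Pi.single (i.succAbove 2) (u.2 : ℤ)) ?_
    (fun y => if (y i = x i ∧ ∀ k, k ≠ i → x k ≤ y k ∧ y k + 1 ≤ N) then
      (2 / (((m y : ℝ) + 1) * ((m y : ℝ) + 2))) ^ 2 else 0) hF0 ?_
  · refine key.trans ?_
    refine (Finset.sum_le_sum fun u _ => hval u).trans ?_
    rw [Finset.sum_product, Finset.sum_product]
    exact sum_theta_sq_le_four N
  · -- injectivity
    intro u _ u' _ h
    have e0 := congrFun h (i.succAbove 0)
    have e1 := congrFun h (i.succAbove 1)
    have e2 := congrFun h (i.succAbove 2)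
    simp only at e0 e1 e2
    rw [param_apply_zero, param_apply_zero] at e0
    rw [param_apply_one, param_apply_one] at e1
    rw [param_apply_two, param_apply_two] at e2
    have a0 : u.1.1 = u'.1.1 := by exact_mod_cast (by omega : (u.1.1 : ℤ) = u'.1.1)
    have a1 : u.1.2 = u'.1.2 := by exact_mod_cast (by omega : (u.1.2 : ℤ) = u'.1.2)
    have a2 : u.2 = u'.2 := by exact_mod_cast (by omega : (u.2 : ℤ) = u'.2)
    exact Prod.ext (Prod.ext a0 a1) a2
  · -- coverage of the support
    intro y hy
    have hR : y i = x i ∧ ∀ k, k ≠ i → x k ≤ y k ∧ y k + 1 ≤ N := by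
      by_contra h; exact hy (by rw [if_neg h])
    obtain ⟨hyi, hreg⟩ := hR
    have a0 := hreg _ (Fin.succAbove_ne i 0)
    have a1 := hreg _ (Fin.succAbove_ne i 1)
    have a2 := hreg _ (Fin.succAbove_ne i 2)
    have x0 := hx (i.succAbove 0)
    have c0 : (((y (i.succAbove 0) - x (i.succAbove 0)).toNat : ℕ) : ℤ) = y (i.succAbove 0) - x (i.succAbove 0) :=
      Int.toNat_of_nonneg (by omega)
    have c1 : (((y (i.succAbove 1) - x (i.succAbove 1)).toNat : ℕ) : ℤ) = y (i.succAbove 1) - x (i.succAbove 1) :=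
      Int.toNat_of_nonneg (by omega)
    have c2 : (((y (i.succAbove 2) - x (i.succAbove 2)).toNat : ℕ) : ℤ) = y (i.succAbove 2) - x (i.succAbove 2) :=
      Int.toNat_of_nonneg (by omega)
    refine ⟨(((y (i.succAbove 0) - x (i.succAbove 0)).toNat, (y (i.succAbove 1) - x (i.succAbove 1)).toNat),
      (y (i.succAbove 2) - x (i.succAbove 2)).toNat), ?_, ?_⟩
    · simp only [Finset.mem_product, Finset.mem_range]
      have x1 := hx (i.succAbove 1); have x2 := hx (i.succAbove 2)
      refine ⟨⟨?_, ?_⟩, ?_⟩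
      · exact_mod_cast (show (((y (i.succAbove 0) - x (i.succAbove 0)).toNat : ℕ) : ℤ) < N by rw [c0]; omega)
      · exact_mod_cast (show (((y (i.succAbove 1) - x (i.succAbove 1)).toNat : ℕ) : ℤ) < N by rw [c1]; omega)
      · exact_mod_cast (show (((y (i.succAbove 2) - x (i.succAbove 2)).toNat : ℕ) : ℤ) < N by rw [c2]; omega)
    · funext k
      simp only
      rw [c0, c1, c2]
      by_cases hk : k = i
      · subst hk
        rw [param_apply_self, hyi]
      · obtain ⟨j, hj⟩ := Fin.exists_succAbove_eq hk
        rw [← hj]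
        fin_cases j
        · simp only [Fin.zero_eta]
          rw [param_apply_zero]; ring
        · simp only [Fin.mk_one]
          rw [param_apply_one]; ring
        · show (x + Pi.single (i.succAbove 0) _ + Pi.single (i.succAbove 1) _ + Pi.single (i.succAbove 2) _ : Fin 4 → ℤ)
              (i.succAbove 2) = y (i.succAbove 2)
          rw [param_apply_two]; ring


end Summit.QuantumFields.YangMills.Theorems.AllWindowsColdBoxBoxHighLine.HodgePoincare
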